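import Literature.AlgebraicGeometry.Resolution.PowerSeriesRegularLocal
import Literature.RingTheory.MvPowerSeries.MaximalIdealPow
import Literature.RingTheory.Derivation.MvPowerSeriesCoeffwise
import Mathlib.RingTheory.MvPowerSeries.Expand
import Mathlib.RingTheory.MvPowerSeries.Order
import Mathlib.FieldTheory.Perfect
import HarnessLib

/-!
# Crux `Steer` (stmt-ResolutionOfSingularities-16345), chain W4.1: ORDER RAISING BY A `p`-TH POWER in `κ⟦X₁, …, Xₙ⟧`
# («`∀ j, ∂_j f ∈ 𝔪^N ⇒ ∃ g, f − g^p ∈ 𝔪^{N+1}`»; Theses-free, definition-free)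

OURS (campaign `res-hironaka`, rung L ★L-G4, slot W4.1; seat res-D-pv-004 AS res-L0-w41-stub-10; replaces the role of
no printed item and is NOT a statement of the manuscript under review [claim: Hironaka2017, status: under-review];
AI-produced, weaker than expert review). ORDER of res-L0-w41-plan-1 (RULING ×6, HOME/STATUS 2026-08-27T07:20:27Z (4)):
«FIRST the e = 0 slice (coefficient field PERFECT …): S = κ⟦u₁..uₙ⟧, κ perfect of char p, f ∈ S:
(∀ j, ∂_{u_j} f ∈ 𝔫^N) → ∃ g, f − g^p ∈ 𝔫^{N+1} … consumer NOW = strat-2's HIGH order-raising steps (B4′ «J(f) ⊆ 𝔪⁴ ⇒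
non-square part of order ≥ 5», every cleaned-order step of the cubic carrier game); THEN the dual-p-basis general
version». Both slices are here.

* `coeff_eq_zero_of_order_pderiv` — if `N ≤ ord ∂_j f` for all `j`, a coefficient `c_A` with `|A| ≤ N` and `p ∤ A_j`
  for some `j` vanishes (it survives in `∂_j f` at degree `|A| − 1 < N`).
* `e = 0` (κ PERFECT): `exists_forall_coeff_sub_pow_eq_zero` (EXACT normal form: `∃ g`, all coefficients of `f − g^p`
  of degree `≤ N` vanish; `g = Σ_{p ∣ A, |A| ≤ N} c_A^{1/p} X^{A/p}`), `exists_sub_pow_order_ge`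
  (`∃ g, N + 1 ≤ ord (f − g^p)`), `exists_sub_pow_mem_maximalIdeal_pow` (`𝔪`-power form, tree bridge
  `Jets.le_order_iff_mem_maximalIdeal_pow`).
* general κ with a KERNEL-EXACT derivation family `D : Fin e → Der(κ)` (`TowerRunI.hD`; e.g. duals of a finite
  `p`-basis): `exists_forall_coeff_sub_pow_eq_zero_of_kernel`, `exists_sub_pow_order_ge_of_kernel` — the extra
  hypothesis is `N + 1 ≤ ord D̃_l f` (coefficient derivations, `Literature.RingTheory.Derivation.MvPowerSeriesCoeffwise`,
  do not lower degrees).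

`∂_j` is the tree's `Literature.AlgebraicGeometry.Resolution.MvPowerSeries.pderiv` (coefficient formula
`(e_j + 1) · c_{e + e_j}`, pointwise the route's `pd`). Mechanism: Mathlib `MvPowerSeries.map_frobenius_expand`
(`(Σ a_B X^B)^p = Σ a_B^p X^{pB}`), `coeff_expand_smul`, `coeff_expand_of_not_dvd`, `MvPowerSeries.nat_le_order`.
Classical computation (the `p`-th power lemma behind Matsumura's Thm. 30.5 / the proof of Thm. 30.9, p. 243:
"`B` is the free `C'`-module with basis the set of `p`-monomials"); nothing is attributed to the manuscript.
[cite: Matsumura1987, §30 p. 243, proof of Thm. 30.9] bears_on: LADDER-RESOLUTION L ★L-G4 W4.1 (crux `Steer`, σ-residual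
HIGH steps / K(3) discharge line).
-/

noncomputable section

set_option linter.dupNamespace false

open IsLocalRing MvPowerSeries

namespace Summit.ResolutionOfSingularities.ResolutionOfSingularities.Theorems.SwitchingDichotomy.OrderRaising

open Literature.AlgebraicGeometry.Resolution Literature.RingTheory.Derivation

universe u

variable (p : ℕ) [hp : Fact p.Prime] {κ : Type u} [Field κ] [CharP κ p] {n : ℕ}

omit hp in
/-- **Low monomials with an exponent prime to `p` are killed by the hypothesis on the partials**: if
`N ≤ ord (∂f/∂X_j)` for all `j`, then every coefficient `c_A` of `f` with `|A| ≤ N` and `p ∤ A_j` for some `j`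
vanishes (the monomial `A_j c_A X^{A − e_j}` of `∂_j f` has degree `|A| − 1 < N`). [folklore] -/
theorem coeff_eq_zero_of_order_pderiv (f : MvPowerSeries (Fin n) κ) (N : ℕ)
    (h : ∀ j, (N : ℕ∞) ≤ (MvPowerSeries.pderiv j f).order) {A : Fin n →₀ ℕ} (hA : A.degree ≤ N)
    {j : Fin n} (hj : ¬ p ∣ A j) : coeff A f = 0 := by
  have hAj : 1 ≤ A j := Nat.pos_of_ne_zero fun h0 => hj (h0 ▸ dvd_zero p)
  -- `A = e + e_j`
  set e : Fin n →₀ ℕ := A - Finsupp.single j 1 with he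
  have hAe : e + Finsupp.single j 1 = A := by
    ext i
    by_cases hij : i = j
    · subst hij; simp [he, Nat.sub_add_cancel hAj]
    · simp [he, Finsupp.single_eq_of_ne hij]
  have hdeg : e.degree < N := by
    have := congrArg Finsupp.degree hAe
    rw [map_add, Finsupp.degree_single] at this
    omega
  have hcoeff : coeff e (MvPowerSeries.pderiv j f) = 0 :=
    MvPowerSeries.coeff_of_lt_order (lt_of_lt_of_le (by exact_mod_cast hdeg) (h j))
  rw [MvPowerSeries.coeff_pderiv, hAe] at hcoeff
  have hne : ((e j : κ) + 1) ≠ 0 := by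
    have : ((e j + 1 : ℕ) : κ) ≠ 0 := by
      rw [Ne, CharP.cast_eq_zero_iff κ p]
      have : e j + 1 = A j := by
        have := DFunLike.congr_fun hAe j
        simpa using this
      rw [this]; exact hj
    exact_mod_cast this
  exact (mul_eq_zero.1 hcoeff).resolve_left hne

variable [PerfectField κ]

/-- **ORDER RAISING BY A `p`-TH POWER (perfect coefficient field, `e = 0` slice; EXACT form).** If
`N ≤ ord (∂f/∂X_j)` for all `j`, then for `g := Σ_{|A| ≤ N, p ∣ A} c_A^{1/p} X^{A/p}` every coefficient of `f − g^p`
of degree `≤ N` vanishes. OURS (plumbing; classical computation). [folklore] -/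
theorem exists_forall_coeff_sub_pow_eq_zero (f : MvPowerSeries (Fin n) κ) (N : ℕ)
    (h : ∀ j, (N : ℕ∞) ≤ (MvPowerSeries.pderiv j f).order) :
    ∃ g : MvPowerSeries (Fin n) κ, ∀ d : Fin n →₀ ℕ, d.degree ≤ N → coeff d (f - g ^ p) = 0 := by
  classical
  have hp0 : p ≠ 0 := hp.out.ne_zero
  haveI : PerfectRing κ p := PerfectField.toPerfectRing p
  -- `g := Σ_B (c_{pB})^{1/p} X^B`
  let g : MvPowerSeries (Fin n) κ := fun B => (frobeniusEquiv κ p).symm (coeff (p • B) f)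
  have hg : ∀ B : Fin n →₀ ℕ, coeff B g = (frobeniusEquiv κ p).symm (coeff (p • B) f) := fun _ => rfl
  refine ⟨g, fun d hd => ?_⟩
  rw [map_sub, sub_eq_zero]
  -- coefficients of `g^p = (expand p g).map frobenius`
  rw [← map_frobenius_expand p hp0, coeff_map]
  by_cases hdiv : ∀ i, p ∣ d i
  · -- `d = p • B`
    choose B hB using hdiv
    have hdB : d = p • (Finsupp.equivFunOnFinite.symm B : Fin n →₀ ℕ) := by
      ext i; simp [hB i]
    rw [hdB, coeff_expand_smul, hg, frobenius_def, ← hdB]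
    change _ = frobeniusEquiv κ p ((frobeniusEquiv κ p).symm (coeff d f))
    rw [RingEquiv.apply_symm_apply]
  · push Not at hdiv
    obtain ⟨i, hi⟩ := hdiv
    rw [coeff_expand_of_not_dvd p hp0 g hi, map_zero]
    exact coeff_eq_zero_of_order_pderiv p f N h hd hi

/-- **ORDER RAISING BY A `p`-TH POWER, order form**: `(∀ j, N ≤ ord ∂_j f) → ∃ g, N + 1 ≤ ord (f − g^p)` over a
PERFECT field of characteristic `p` (res-L0-w41-plan-1 RULING ×6 2026-08-27T07:20:27Z (4), the `e = 0` slice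
consumed by the `p = 2` σ-residual's order-raising steps). OURS. [folklore] -/
theorem exists_sub_pow_order_ge (f : MvPowerSeries (Fin n) κ) (N : ℕ)
    (h : ∀ j, (N : ℕ∞) ≤ (MvPowerSeries.pderiv j f).order) :
    ∃ g : MvPowerSeries (Fin n) κ, ((N + 1 : ℕ) : ℕ∞) ≤ (f - g ^ p).order := by
  obtain ⟨g, hg⟩ := exists_forall_coeff_sub_pow_eq_zero p f N h
  exact ⟨g, MvPowerSeries.nat_le_order fun d hd => hg d (by exact_mod_cast Nat.lt_succ_iff.mp (by exact_mod_cast hd))⟩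

/-- **ORDER RAISING BY A `p`-TH POWER, `𝔪`-power form**: `(∀ j, ∂_j f ∈ 𝔪^N) → ∃ g, f − g^p ∈ 𝔪^{N+1}` in
`κ⟦X₁, …, Xₙ⟧`, `κ` perfect of characteristic `p` (tree bridge `Jets.le_order_iff_mem_maximalIdeal_pow`). OURS. [folklore] -/
theorem exists_sub_pow_mem_maximalIdeal_pow (f : MvPowerSeries (Fin n) κ) (N : ℕ)
    (h : ∀ j, MvPowerSeries.pderiv j f ∈ maximalIdeal (MvPowerSeries (Fin n) κ) ^ N) :
    ∃ g : MvPowerSeries (Fin n) κ, f - g ^ p ∈ maximalIdeal (MvPowerSeries (Fin n) κ) ^ (N + 1) := by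
  obtain ⟨g, hg⟩ := exists_sub_pow_order_ge p f N fun j =>
    Literature.RingTheory.MvPowerSeries.Jets.le_order_iff_mem_maximalIdeal_pow.mpr (h j)
  exact ⟨g, Literature.RingTheory.MvPowerSeries.Jets.le_order_iff_mem_maximalIdeal_pow.mp hg⟩

/-! ## The general slice: imperfect coefficient field with a kernel-exact derivation family -/

omit [PerfectField κ] in
/-- **ORDER RAISING BY A `p`-TH POWER over an IMPERFECT field (EXACT form).** Let `D : Fin e → Der(κ)` be a family whose
common kernel consists of `p`-th powers (`TowerRunI.hD`; e.g. the duals of a finite `p`-basis). If `N ≤ ord (∂f/∂X_j)`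
for all `j` and the coefficient derivations `D̃_l f` have no terms of degree `≤ N`, then for a suitable `g` every
coefficient of `f − g^p` of degree `≤ N` vanishes: the surviving low monomials have `p ∣ A` (partials) and coefficients
killed by every `D l` (coefficient derivations), hence `p`-th powers. OURS. [folklore] -/
theorem exists_forall_coeff_sub_pow_eq_zero_of_kernel {e : ℕ} (D : Fin e → Derivation ℤ κ κ)
    (hker : ∀ z : κ, (∀ l, D l z = 0) → ∃ y : κ, y ^ p = z) (f : MvPowerSeries (Fin n) κ) (N : ℕ)
    (h : ∀ j, (N : ℕ∞) ≤ (MvPowerSeries.pderiv j f).order)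
    (hD : ∀ l (d : Fin n →₀ ℕ), d.degree ≤ N → coeff d ((D l).mvPowerSeriesCoeffwise f) = 0) :
    ∃ g : MvPowerSeries (Fin n) κ, ∀ d : Fin n →₀ ℕ, d.degree ≤ N → coeff d (f - g ^ p) = 0 := by
  classical
  have hp0 : p ≠ 0 := hp.out.ne_zero
  haveI : ExpChar κ p := ExpChar.prime hp.out
  -- `g := Σ_B y_B X^B` with `y_B^p = c_{pB}` whenever `|pB| ≤ N` (then all `D l` kill `c_{pB}`)
  have hroot : ∀ B : Fin n →₀ ℕ, (p • B).degree ≤ N → ∃ y : κ, y ^ p = coeff (p • B) f := by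
    intro B hB
    refine hker _ fun l => ?_
    rw [← coeff_mvPowerSeriesCoeffwise]
    exact hD l _ hB
  let g : MvPowerSeries (Fin n) κ := fun B =>
    if hB : (p • B).degree ≤ N then Classical.choose (hroot B hB) else 0
  have hg : ∀ B : Fin n →₀ ℕ, (p • B).degree ≤ N → coeff B g ^ p = coeff (p • B) f := by
    intro B hB
    change (g B) ^ p = _
    simp only [g, dif_pos hB]
    exact Classical.choose_spec (hroot B hB)
  refine ⟨g, fun d hd => ?_⟩
  rw [map_sub, sub_eq_zero, ← map_frobenius_expand p hp0, coeff_map]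
  by_cases hdiv : ∀ i, p ∣ d i
  · choose B hB using hdiv
    have hdB : d = p • (Finsupp.equivFunOnFinite.symm B : Fin n →₀ ℕ) := by
      ext i; simp [hB i]
    rw [hdB, coeff_expand_smul, frobenius_def, hg _ (hdB ▸ hd)]
  · push Not at hdiv
    obtain ⟨i, hi⟩ := hdiv
    rw [coeff_expand_of_not_dvd p hp0 g hi, map_zero]
    exact coeff_eq_zero_of_order_pderiv p f N h hd hi

omit [PerfectField κ] in
/-- **ORDER RAISING, order form, imperfect field**: `(∀ j, N ≤ ord ∂_j f) → (∀ l, N + 1 ≤ ord D̃_l f) → ∃ g,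
N + 1 ≤ ord (f − g^p)` for a kernel-exact derivation family `D` of `κ`. OURS. [folklore] -/
theorem exists_sub_pow_order_ge_of_kernel {e : ℕ} (D : Fin e → Derivation ℤ κ κ)
    (hker : ∀ z : κ, (∀ l, D l z = 0) → ∃ y : κ, y ^ p = z) (f : MvPowerSeries (Fin n) κ) (N : ℕ)
    (h : ∀ j, (N : ℕ∞) ≤ (MvPowerSeries.pderiv j f).order)
    (hD : ∀ l, ((N + 1 : ℕ) : ℕ∞) ≤ ((D l).mvPowerSeriesCoeffwise f).order) :
    ∃ g : MvPowerSeries (Fin n) κ, ((N + 1 : ℕ) : ℕ∞) ≤ (f - g ^ p).order := by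
  obtain ⟨g, hg⟩ := exists_forall_coeff_sub_pow_eq_zero_of_kernel p D hker f N h fun l d hd =>
    MvPowerSeries.coeff_of_lt_order (lt_of_lt_of_le (by exact_mod_cast Nat.lt_succ_iff.mpr hd) (hD l))
  exact ⟨g, MvPowerSeries.nat_le_order fun d hd => hg d (by exact_mod_cast Nat.lt_succ_iff.mp (by exact_mod_cast hd))⟩

/-! ## The converse and the CLEANED-ORDER FORMULA (res-L0-w41-plan-1 RULING 23 (e), 2026-08-27T08:53:23Z) -/

omit hp [CharP κ p] [PerfectField κ] in
/-- `∂_j` lowers the order by at most one: `N + 1 ≤ ord h → N ≤ ord (∂_j h)`. [folklore] -/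
theorem le_order_pderiv_of_succ_le_order (h : MvPowerSeries (Fin n) κ) (N : ℕ) (j : Fin n)
    (hN : ((N + 1 : ℕ) : ℕ∞) ≤ h.order) : (N : ℕ∞) ≤ (MvPowerSeries.pderiv j h).order := by
  refine MvPowerSeries.nat_le_order fun d hd => ?_
  rw [MvPowerSeries.coeff_pderiv]
  have hdeg : ((d + Finsupp.single j 1).degree : ℕ∞) < ((N + 1 : ℕ) : ℕ∞) := by
    rw [map_add, Finsupp.degree_single]
    exact_mod_cast Nat.add_lt_add_right (by exact_mod_cast hd) 1
  rw [MvPowerSeries.coeff_of_lt_order (lt_of_lt_of_le hdeg hN), mul_zero]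

omit hp [PerfectField κ] in
/-- `∂_j` kills `p`-th powers in characteristic `p`. [folklore] -/
theorem pderiv_pow_char (g : MvPowerSeries (Fin n) κ) (j : Fin n) : MvPowerSeries.pderiv j (g ^ p) = 0 := by
  rw [(MvPowerSeries.pderiv j).leibniz_pow, nsmul_eq_mul]
  have : ((p : ℕ) : MvPowerSeries (Fin n) κ) = 0 := by
    rw [← map_natCast (C : κ →+* MvPowerSeries (Fin n) κ) p, CharP.cast_eq_zero, map_zero]
  rw [this, zero_mul]

omit hp [PerfectField κ] in
/-- The EASY direction of (E0-iff), valid over any field of characteristic `p`: if `N + 1 ≤ ord (f − g^p)` for some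
`g`, then `N ≤ ord (∂_j f)` for every `j` (`∂_j` kills `g^p` and lowers orders by at most one). [folklore] -/
theorem forall_le_order_pderiv_of_exists_sub_pow (f : MvPowerSeries (Fin n) κ) (N : ℕ)
    (h : ∃ g : MvPowerSeries (Fin n) κ, ((N + 1 : ℕ) : ℕ∞) ≤ (f - g ^ p).order) (j : Fin n) :
    (N : ℕ∞) ≤ (MvPowerSeries.pderiv j f).order := by
  obtain ⟨g, hg⟩ := h
  have := le_order_pderiv_of_succ_le_order (f - g ^ p) N j hg
  rwa [map_sub, pderiv_pow_char p, sub_zero] at this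

/-- **(E0-iff) — ORDER RAISING IS SHARP** (κ perfect of characteristic `p`): `(∀ j, N ≤ ord ∂_j f) ↔ ∃ g, N + 1 ≤
ord (f − g^p)`. OURS. [folklore] -/
theorem forall_le_order_pderiv_iff_exists_sub_pow (f : MvPowerSeries (Fin n) κ) (N : ℕ) :
    (∀ j, (N : ℕ∞) ≤ (MvPowerSeries.pderiv j f).order) ↔
      ∃ g : MvPowerSeries (Fin n) κ, ((N + 1 : ℕ) : ℕ∞) ≤ (f - g ^ p).order :=
  ⟨exists_sub_pow_order_ge p f N, forall_le_order_pderiv_of_exists_sub_pow p f N⟩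

/-- **THE CLEANED-ORDER FORMULA** (κ perfect of characteristic `p`; def-free): the best order of `f` modulo `p`-th powers
— the CLEANED ORDER `sup_g ord (f − g^p)` — equals `1 + min_j ord (∂f/∂X_j)` (in `ℕ∞`; both sides are `⊤` iff all
partials vanish iff `f` is a `p`-th power). res-L0-w41-plan-1 RULING 23 (e): «the cleaned-order formula the F-B ideation and
any point-game invariant will cite». OURS. [folklore] -/
theorem iSup_order_sub_pow_eq (f : MvPowerSeries (Fin n) κ) :
    (⨆ g : MvPowerSeries (Fin n) κ, (f - g ^ p).order) = (⨅ j, (MvPowerSeries.pderiv j f).order) + 1 := by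
  -- `m = min_j ord ∂_j f`
  rcases eq_or_ne (⨅ j, (MvPowerSeries.pderiv j f).order) ⊤ with htop | hfin
  · -- all partials vanish: `f` is a `p`-th power to every order, so the sup is `⊤`
    rw [htop, top_add, eq_top_iff]
    have hall : ∀ N : ℕ, ∃ g : MvPowerSeries (Fin n) κ, ((N + 1 : ℕ) : ℕ∞) ≤ (f - g ^ p).order := fun N =>
      exists_sub_pow_order_ge p f N fun j => (iInf_eq_top.1 htop j).symm ▸ le_top
    refine ENat.forall_natCast_le_iff_le.1 fun N _ => ?_
    obtain ⟨g, hg⟩ := hall N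
    have h1 : (N : ℕ∞) ≤ ((N + 1 : ℕ) : ℕ∞) := by exact_mod_cast Nat.le_succ N
    exact le_trans h1 (le_trans hg (le_iSup (fun g => (f - g ^ p).order) g))
  · obtain ⟨N, hN⟩ := ENat.ne_top_iff_exists.1 hfin
    rw [← hN]
    have hNle : ∀ j, (N : ℕ∞) ≤ (MvPowerSeries.pderiv j f).order := fun j => hN ▸ iInf_le _ j
    apply le_antisymm
    · -- every `g` has `ord (f − g^p) ≤ N + 1`, else all partials would have order `≥ N + 1`
      refine iSup_le fun g => ?_
      by_contra hlt
      push Not at hlt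
      have hge : ((N + 1 + 1 : ℕ) : ℕ∞) ≤ (f - g ^ p).order := by
        have : ((N : ℕ∞) + 1) = ((N + 1 : ℕ) : ℕ∞) := by norm_cast
        rw [this] at hlt
        exact Order.add_one_le_of_lt (by exact_mod_cast hlt)
      have hj : ∀ j, ((N + 1 : ℕ) : ℕ∞) ≤ (MvPowerSeries.pderiv j f).order :=
        forall_le_order_pderiv_of_exists_sub_pow p f (N + 1) ⟨g, hge⟩
      have : ((N + 1 : ℕ) : ℕ∞) ≤ ⨅ j, (MvPowerSeries.pderiv j f).order := le_iInf hj
      rw [← hN] at this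
      exact absurd (by exact_mod_cast this : N + 1 ≤ N) (by omega)
    · obtain ⟨g, hg⟩ := exists_sub_pow_order_ge p f N hNle
      have : ((N : ℕ∞) + 1) = ((N + 1 : ℕ) : ℕ∞) := by norm_cast
      rw [this]
      exact le_trans hg (le_iSup (fun g => (f - g ^ p).order) g)

/-! ## The imperfect-field `iff` (kernel-exact frame): the ring side of `MultP⁺` -/

omit hp [CharP κ p] [PerfectField κ] in
/-- Coefficient derivations do not lower the order: `ord h ≤ ord (D̃ h)`. [folklore] -/
theorem order_le_order_coeffwise (δ : Derivation ℤ κ κ) (h : MvPowerSeries (Fin n) κ) :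
    h.order ≤ (δ.mvPowerSeriesCoeffwise h).order := by
  refine MvPowerSeries.le_order fun d hd => ?_
  rw [coeff_mvPowerSeriesCoeffwise, MvPowerSeries.coeff_of_lt_order hd, map_zero]

omit hp [PerfectField κ] in
/-- Coefficient derivations kill `p`-th powers. [folklore] -/
theorem coeffwise_pow_char (δ : Derivation ℤ κ κ) (g : MvPowerSeries (Fin n) κ) :
    δ.mvPowerSeriesCoeffwise (g ^ p) = 0 := by
  rw [(δ.mvPowerSeriesCoeffwise (σ := Fin n)).leibniz_pow, nsmul_eq_mul]
  have : ((p : ℕ) : MvPowerSeries (Fin n) κ) = 0 := by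
    rw [← map_natCast (C : κ →+* MvPowerSeries (Fin n) κ) p, CharP.cast_eq_zero, map_zero]
  rw [this, zero_mul]

omit [PerfectField κ] in
/-- **ORDER RAISING IS SHARP over an IMPERFECT field with a kernel-exact derivation family** (`TowerRunI.hD`):
`(∀ j, N ≤ ord ∂_j f) ∧ (∀ l, N + 1 ≤ ord D̃_l f) ↔ ∃ g, N + 1 ≤ ord (f − g^p)`. With `N = p − 1` this is the ring side of the
tower's `MultP⁺` («cleaned order ≥ p»): `∃ h, f − h^p ∈ 𝔪^p` (R3d of `D/res-D-pv-004/K3-SCOPING.md`). OURS. [folklore] -/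
theorem forall_le_order_iff_exists_sub_pow_of_kernel {e : ℕ} (D : Fin e → Derivation ℤ κ κ)
    (hker : ∀ z : κ, (∀ l, D l z = 0) → ∃ y : κ, y ^ p = z) (f : MvPowerSeries (Fin n) κ) (N : ℕ) :
    ((∀ j, (N : ℕ∞) ≤ (MvPowerSeries.pderiv j f).order) ∧
        ∀ l, ((N + 1 : ℕ) : ℕ∞) ≤ ((D l).mvPowerSeriesCoeffwise f).order) ↔
      ∃ g : MvPowerSeries (Fin n) κ, ((N + 1 : ℕ) : ℕ∞) ≤ (f - g ^ p).order := by
  constructor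
  · rintro ⟨h, hD⟩
    exact exists_sub_pow_order_ge_of_kernel p D hker f N h hD
  · intro h
    refine ⟨forall_le_order_pderiv_of_exists_sub_pow p f N h, fun l => ?_⟩
    obtain ⟨g, hg⟩ := h
    have := le_trans hg (order_le_order_coeffwise (D l) (f - g ^ p))
    rwa [map_sub, coeffwise_pow_char p, sub_zero] at this

end Summit.ResolutionOfSingularities.ResolutionOfSingularities.Theorems.SwitchingDichotomy.OrderRaising

end
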